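import Literature.Probability.FitznerVanDerHofstad2017.NoblePhiRemWeighted
import Literature.Probability.FitznerVanDerHofstad2017.NobleFRemL1
import HarnessLib

/-!
# The extended simplified form with (D.13) and (D.21) proved — assembly

[NoBLE17] = Fitzner–van der Hofstad, *Generalized approach to the non-backtracking lace expansion*,
PTRF 169 (2017), Prop. 4.5 and App. D.

`NoblePhiRemWeighted.nobleSimplifiedFormF3At_of_assumptions₆` assembles the extended simplified rewrite from
Assumptions 4.1–4.3 with the two named analytic hypotheses (D.13) and (D.29) on the constructed remainder `R_F`;
`NobleFRemL1.nobleFRem_l1_le_extraOfInputs` proves (D.13) (`Σ_x |R_F(x)| ≤ BetaMap.extraOfInputs d i 2`) under the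
decidable side condition `(2d−1)·i.mub ≤ 2d·i.mu` on the record (see that module's docstring for the one coefficient
of the notebook's `betaRF` this condition accounts for; without it the bound holds with the constant `BetaMap.betaRFSq`).
This module records the corollary: the assembly with (D.13) discharged, whose only remaining named analytic
hypothesis is (D.29).  Additive: no existing module is modified.
-/

namespace Literature.Probability.FitznerVanDerHofstad2017

open scoped BigOperators
open Literature.Probability.LatticeModels
open Literature.Probability.Percolation
open Literature.Barriers.CriticalPhenomena
open Literature.Probability.RandomPlanarGeometry.SAW.Zd (normSq)

variable {d : ℕ}

section D13Assembly

local notation "𝐞" => Literature.Probability.Percolation.stepVec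

variable {p : unitInterval} {i : BetaMap.Inputs} {S : NobleSplit d p}

variable (hd : 2 ≤ d) (hp : p < criticalProbI d)
include hd hp

/-- **[NoBLE17, Prop. 4.5(ii) / App. D — extended form with (D.13) and (D.21) PROVED].** As
`nobleSimplifiedFormF3At_of_assumptions₆` but WITHOUT the hypothesis (D.13), replaced by the decidable side
condition `hcapQ : (2d−1)·i.mub ≤ 2d·i.mu` under which the bookkeeping constant is at most the wired `betaRF`;
the only remaining named analytic hypothesis is (D.29).
[cite: FitznerVanDerHofstad2016NoBLE, Prop. 4.5 (p. 1088); App. D (D.2), (D.3) (p. 1111), (D.13) (p. 1113), (D.21) (p. 1115), (D.29) (p. 1116)] -/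
theorem nobleSimplifiedFormF3At_of_assumptions₇ (hp0 : 0 < (p : ℝ)) (hWF : NobleInputsWF d i)
    (hE : PercolationNobleEquationAt d p) (h41 : NobleAssumption41At d p S) (h43 : NobleAssumption43At d p S i)
    (hTRS : IsTRS (fun x => ∑ ι, S.xiIotaAI ι (x + 𝐞 ι)))
    (hI : ∀ N ≤ 1, IsTRS (fun x => ∑ ι, S.psiAI N ι (x + 𝐞 ι)))
    (hPi : IsTRS (fun x => ∑ ι, ∑ κ, S.piA ι κ (x + 𝐞 ι + 𝐞 κ)))
    (hN1 : 0 ≤ BetaMap.betaCPhiLow d i.mu i.xiAlphaOneMinusZeroAtZero i.xiIotaAlphaIAtEi)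
    (hN2 : i.xiAbs + i.xiIotaAbs < 1) (hN3 : (BetaMap.nobleBetaOfInputs d i).βΨ < 1)
    (hN4 : 0 ≤ (BetaMap.nobleBetaOfInputs d i).αFlow)
    (hcap : i.mu ≤ 7 / 10) (hcapP : i.piAlphaLower ≤ 1 / 8) (hcapQ : (2 * d - 1) * i.mub ≤ 2 * d * i.mu)
    (hD29 : (Summable fun x => normSq x * |nobleFRem S x|) ∧
      ∑' x, normSq x * |nobleFRem S x| ≤ BetaMap.extraOfInputs d i 4) :
    NobleSimplifiedFormF3At d p (BetaMap.nobleBetaOfInputsCorr d i)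
      (NobleBetaF3.ofFn (BetaMap.extraOfInputsCorr d i)) :=
  nobleSimplifiedFormF3At_of_assumptions₆ hd hp hp0 hWF hE h41 h43 hTRS hI hPi hN1 hN2 hN3 hN4 hcap hcapP
    (nobleFRem_l1_le_extraOfInputs hd hp hp0 hWF h43 (isTRS_nobleFAlpha h41 hI hPi) hcapQ).2 hD29

/-- **Percolation instance** of `nobleSimplifiedFormF3At_of_assumptions₇` (`S := percolationNobleSplit d p`): the
remaining inputs are the NoBLE equation, Assumption 4.3 with constants `i`, the decidable sign conditions and caps,
and the one named analytic hypothesis (D.29).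
[cite: FitznerVanDerHofstad2016NoBLE, Prop. 4.5 (p. 1088), App. D (pp. 1110–1117); FitznerVanDerHofstad2017, §3.5] -/
theorem nobleSimplifiedFormF3At_percolation₇ (hp0 : 0 < (p : ℝ)) (hWF : NobleInputsWF d i)
    (hE : PercolationNobleEquationAt d p) (h43 : NobleAssumption43At d p (percolationNobleSplit d p hd hp) i)
    (hN1 : 0 ≤ BetaMap.betaCPhiLow d i.mu i.xiAlphaOneMinusZeroAtZero i.xiIotaAlphaIAtEi)
    (hN2 : i.xiAbs + i.xiIotaAbs < 1) (hN3 : (BetaMap.nobleBetaOfInputs d i).βΨ < 1)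
    (hN4 : 0 ≤ (BetaMap.nobleBetaOfInputs d i).αFlow)
    (hcap : i.mu ≤ 7 / 10) (hcapP : i.piAlphaLower ≤ 1 / 8) (hcapQ : (2 * d - 1) * i.mub ≤ 2 * d * i.mu)
    (hD29 : (Summable fun x => normSq x * |nobleFRem (percolationNobleSplit d p hd hp) x|) ∧
      ∑' x, normSq x * |nobleFRem (percolationNobleSplit d p hd hp) x| ≤ BetaMap.extraOfInputs d i 4) :
    NobleSimplifiedFormF3At d p (BetaMap.nobleBetaOfInputsCorr d i)
      (NobleBetaF3.ofFn (BetaMap.extraOfInputsCorr d i)) :=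
  nobleSimplifiedFormF3At_of_assumptions₇ hd hp hp0 hWF hE (nobleAssumption41At_percolation hd p hp) h43
    (percolationNobleSplit_xiIotaAI_shift_trs hd hp) (fun N _ => percolationNobleSplit_psiAI_shift_trs hd hp N)
    (percolationNobleSplit_piA_shift_trs hd hp) hN1 hN2 hN3 hN4 hcap hcapP hcapQ hD29

end D13Assembly

end Literature.Probability.FitznerVanDerHofstad2017
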